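import Mathlib
import Literature.Combinatorics.Optimization.RandomPairMultigraphCuts
import HarnessLib

/-!
# Random sparse multigraphs, II: first moments (loops, repeated pairs, degrees, short cycles,
# locally dense sets)

[topic Combinatorics/Optimization]

Second file toward the graph family of the CMM MAX-CUT gap (`CharikarMakarychevMakarychev2009_gapGraphs`)
in the random pair multigraph model of `RandomPairMultigraphCuts.lean` (`ω : Fin M → Fin n × Fin n`
uniform).  Following the first-moment method of [AroraBollobasLovaszTourlakis2006] Lemma 2.8
(p. 26–27: "the expected number of cycles of length at most `g` is … Deleting an edge from each of
these cycles then gives a graph of girth at least `g`"; "every subgraph of `H` with `ℓ ≤ βn`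
vertices contains at most `(1+η)ℓ` edges"), we COUNT:

* `card_coordConstraints` / `card_mem_on` — outcomes with prescribed coordinates in prescribed
  sets (`Π_i |B_i|`), `card_atLeast_le` — at least `r` coordinates in `B`
  (`≤ C(M,r)|B|^r(n²)^{M−r}`);
* `sum_loopCount` (`= M·n·(n²)^{M−1}`), `sum_repCount_le` (ordered colliding pairs,
  `≤ 2M²(n²)^{M−1}`), `sum_sq_deg_le` (second moment of a vertex degree), `sum_highIncidences_le`
  (incidences at vertices of degree `≥ D`), `sum_shortCircuits_le` (closed index/vertex tuples of
  length `≤ g`, `≤ (n²)^M Σ_{j≤g} (2M/n)^j`), `card_exists_dense_le` (some `≤ K`-set `W` carrying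
  `≥ r(W)` pairs, `≤ Σ_W C(M,r)(|W|²)^r(n²)^{M−r}`).

Everything is proved; no named facts.

## References

* [AroraBollobasLovaszTourlakis2006] Theory of Computing 2 (2006), Lemma 2.8 and proof (p. 26–27).
* [CharikarMakarychevMakarychev2009] STOC 2009, §5 p. 10–11.
-/

noncomputable section

open Finset Real

namespace Literature.Combinatorics.Optimization

namespace RandomPairs

variable {n M : ℕ}

/-! ### Coordinate constraints -/

/-- **Prescribed coordinates in prescribed sets**: `#{ω : ∀ i, ω i ∈ B i} = Π_i |B i|`.
[cite: AroraBollobasLovaszTourlakis2006, Lemma 2.8 proof (p. 26)] -/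
theorem card_coordConstraints {α : Type*} [Fintype α] [DecidableEq α] (B : Fin M → Finset α) :
    ((univ : Finset (Fin M → α)).filter fun ω => ∀ i, ω i ∈ B i).card = ∏ i, (B i).card := by
  rw [← Fintype.card_piFinset]
  congr 1
  ext ω
  simp [Fintype.mem_piFinset]

/-- **Coordinates in `I` constrained to `B`**: `#{ω : ∀ i ∈ I, ω i ∈ B} = |B|^{|I|} · |α|^{M−|I|}`.
[cite: AroraBollobasLovaszTourlakis2006, Lemma 2.8 proof (p. 26)] -/
theorem card_mem_on {α : Type*} [Fintype α] [DecidableEq α] (I : Finset (Fin M)) (B : Finset α) :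
    ((univ : Finset (Fin M → α)).filter fun ω => ∀ i ∈ I, ω i ∈ B).card =
      B.card ^ I.card * (Fintype.card α) ^ (M - I.card) := by
  classical
  have h := card_coordConstraints (M := M) (fun i => if i ∈ I then B else (univ : Finset α))
  have hset : ((univ : Finset (Fin M → α)).filter fun ω => ∀ i, ω i ∈ (if i ∈ I then B else univ)) =
      (univ.filter fun ω => ∀ i ∈ I, ω i ∈ B) := by
    ext ω
    simp only [mem_filter, mem_univ, true_and]
    constructor
    · intro h i hi; have := h i; rwa [if_pos hi] at this
    · intro h i; split_ifs with hi
      · exact h i hi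
      · exact mem_univ _
  rw [hset] at h
  rw [h]
  have hc : ∀ i : Fin M, ((if i ∈ I then B else (univ : Finset α)).card) =
      if i ∈ I then B.card else Fintype.card α := fun i => by
    split_ifs <;> simp
  simp_rw [hc]
  rw [Finset.prod_ite, prod_const, prod_const]
  have h1 : ((univ : Finset (Fin M)).filter fun i => i ∈ I) = I := by ext i; simp
  have h2 : ((univ : Finset (Fin M)).filter fun i => ¬ i ∈ I).card = M - I.card := by
    have : ((univ : Finset (Fin M)).filter fun i => ¬ i ∈ I) = univ \ I := by ext i; simp
    rw [this, Finset.card_univ_sdiff, Fintype.card_fin]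
  rw [h1, h2]

/-- **At least `r` coordinates in `B`**: `#{ω : r ≤ #{i : ω i ∈ B}} ≤ C(M,r)·|B|^r·|α|^{M−r}`.
[cite: AroraBollobasLovaszTourlakis2006, Lemma 2.8 proof (p. 27: "every subgraph … contains at most (1+η)ℓ edges")] -/
theorem card_atLeast_le {α : Type*} [Fintype α] [DecidableEq α] (B : Finset α) (r : ℕ) :
    ((univ : Finset (Fin M → α)).filter fun ω =>
        r ≤ ((univ : Finset (Fin M)).filter fun i => ω i ∈ B).card).card ≤
      M.choose r * (B.card ^ r * (Fintype.card α) ^ (M - r)) := by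
  classical
  set S := (univ : Finset (Fin M → α)).filter fun ω =>
        r ≤ ((univ : Finset (Fin M)).filter fun i => ω i ∈ B).card with hS
  set U := (powersetCard r (univ : Finset (Fin M))).biUnion fun I =>
        (univ : Finset (Fin M → α)).filter fun ω => ∀ i ∈ I, ω i ∈ B with hU
  have hsub : S ⊆ U := by
    intro ω hω
    obtain ⟨I, hI, hIc⟩ := Finset.exists_subset_card_eq (mem_filter.1 hω).2
    refine mem_biUnion.2 ⟨I, mem_powersetCard.2 ⟨subset_univ _, hIc⟩, mem_filter.2 ⟨mem_univ _, ?_⟩⟩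
    intro i hi
    exact (mem_filter.1 (hI hi)).2
  have hU' : U.card ≤ ∑ I ∈ powersetCard r (univ : Finset (Fin M)),
      ((univ : Finset (Fin M → α)).filter fun ω => ∀ i ∈ I, ω i ∈ B).card := card_biUnion_le
  have hsum : ∑ I ∈ powersetCard r (univ : Finset (Fin M)),
      ((univ : Finset (Fin M → α)).filter fun ω => ∀ i ∈ I, ω i ∈ B).card =
      M.choose r * (B.card ^ r * (Fintype.card α) ^ (M - r)) := by
    rw [sum_congr rfl fun I hI => by rw [card_mem_on, (mem_powersetCard.1 hI).2], sum_const,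
      card_powersetCard, card_univ, Fintype.card_fin, smul_eq_mul]
  exact (card_le_card hsub).trans (hU'.trans hsum.le)

/-- Linearity: `Σ_ω #{i : ω i ∈ B} = M · |B| · |α|^{M−1}`. [cite: AroraBollobasLovaszTourlakis2006, Lemma 2.8 proof (p. 26–27)] -/
theorem sum_card_coord_mem {α : Type*} [Fintype α] [DecidableEq α] (B : Finset α) :
    ∑ ω : Fin M → α, ((univ : Finset (Fin M)).filter fun i => ω i ∈ B).card =
      M * (B.card * (Fintype.card α) ^ (M - 1)) := by
  classical
  simp_rw [Finset.card_filter]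
  rw [Finset.sum_comm]
  have : ∀ i : Fin M, ∑ ω : Fin M → α, (if ω i ∈ B then 1 else 0) = B.card * (Fintype.card α) ^ (M - 1) := by
    intro i
    rw [Finset.sum_boole, Nat.cast_id]
    have := card_mem_on (M := M) ({i} : Finset (Fin M)) B
    simp only [mem_singleton, forall_eq, card_singleton, pow_one] at this
    exact this
  rw [Finset.sum_congr rfl fun i _ => this i, sum_const, card_univ, Fintype.card_fin, smul_eq_mul]

/-! ### Loops and repeated pairs -/

/-- The number of sampled loops `(v, v)`. [cite: AroraBollobasLovaszTourlakis2006, Lemma 2.8 proof (p. 26: alterations)] -/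
def loopCount (ω : Fin M → Fin n × Fin n) : ℕ :=
  ((univ : Finset (Fin M)).filter fun i => (ω i).1 = (ω i).2).card

/-- **First moment of the loops**: `Σ_ω loopCount ω = M · n · (n²)^{M−1}` (mean `M/n`).
[cite: AroraBollobasLovaszTourlakis2006, Lemma 2.8 proof (p. 26–27)] -/
theorem sum_loopCount : ∑ ω : Fin M → Fin n × Fin n, loopCount ω = M * (n * (n * n) ^ (M - 1)) := by
  classical
  have h := sum_card_coord_mem (M := M) ((univ : Finset (Fin n × Fin n)).filter fun p => p.1 = p.2)
  have hdiag : ((univ : Finset (Fin n × Fin n)).filter fun p => p.1 = p.2).card = n := by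
    have : ((univ : Finset (Fin n × Fin n)).filter fun p => p.1 = p.2) =
        (univ : Finset (Fin n)).image fun a => (a, a) := by
      ext p
      simp only [mem_filter, mem_univ, true_and, mem_image]
      constructor
      · intro h; exact ⟨p.1, by rw [Prod.ext_iff]; exact ⟨rfl, h⟩⟩
      · rintro ⟨a, rfl⟩; rfl
    rw [this, card_image_of_injective _ (fun a b h => by simpa using congrArg Prod.fst h), card_univ,
      Fintype.card_fin]
  rw [hdiag, Fintype.card_prod, Fintype.card_fin] at h
  rw [← h]
  refine Finset.sum_congr rfl fun ω _ => ?_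
  unfold loopCount
  congr 1; ext i; simp

/-- The number of ordered pairs of distinct indices carrying the same unordered pair.
[cite: AroraBollobasLovaszTourlakis2006, Lemma 2.8 proof (p. 26: alterations)] -/
def repCount (ω : Fin M → Fin n × Fin n) : ℕ :=
  ((univ : Finset (Fin M)).offDiag.filter fun ij => s((ω ij.1).1, (ω ij.1).2) = s((ω ij.2).1, (ω ij.2).2)).card

/-- At most two ordered pairs have a given unordered image. [cite: AroraBollobasLovaszTourlakis2006, Lemma 2.8 proof (p. 26)] -/
theorem card_mk_eq_le (e : Sym2 (Fin n)) :
    ((univ : Finset (Fin n × Fin n)).filter fun q : Fin n × Fin n => s(q.1, q.2) = e).card ≤ 2 := by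
  classical
  induction e using Sym2.ind with
  | h a b =>
    calc ((univ : Finset (Fin n × Fin n)).filter fun q : Fin n × Fin n => s(q.1, q.2) = s(a, b)).card
        ≤ ({(a, b), (b, a)} : Finset (Fin n × Fin n)).card := by
          refine card_le_card fun q hq => ?_
          have h := (mem_filter.1 hq).2
          rw [Sym2.eq_iff] at h
          simp only [mem_insert, mem_singleton, Prod.ext_iff]
          rcases h with ⟨h1, h2⟩ | ⟨h1, h2⟩
          · exact Or.inl ⟨h1, h2⟩
          · exact Or.inr ⟨h1, h2⟩
      _ ≤ 2 := card_insert_le _ _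

/-- Products over `Fin M` with two exceptional factors. [cite: AroraBollobasLovaszTourlakis2006, Lemma 2.8 proof (p. 26)] -/
theorem prod_two_exceptions {i j : Fin M} (hij : i ≠ j) (c : Fin M → ℕ) {N : ℕ}
    (hc : ∀ k, k ≠ i → k ≠ j → c k = N) : ∏ k, c k = c i * (c j * N ^ (M - 2)) := by
  classical
  rw [← Finset.mul_prod_erase univ c (mem_univ i), ← Finset.mul_prod_erase (univ.erase i) c
    (mem_erase.2 ⟨Ne.symm hij, mem_univ j⟩)]
  congr 2
  rw [Finset.prod_congr rfl fun k hk => hc k (ne_of_mem_erase (mem_of_mem_erase hk)) (ne_of_mem_erase hk),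
    prod_const]
  congr 1
  rw [card_erase_of_mem (mem_erase.2 ⟨Ne.symm hij, mem_univ j⟩), card_erase_of_mem (mem_univ i),
    card_univ, Fintype.card_fin]
  omega

/-- **First moment of the repeated pairs**: `Σ_ω repCount ω ≤ M² · 2n² · (n²)^{M−2}` (mean `≤ 2M²/n²`).
[cite: AroraBollobasLovaszTourlakis2006, Lemma 2.8 proof (p. 26–27)] -/
theorem sum_repCount_le :
    ∑ ω : Fin M → Fin n × Fin n, repCount ω ≤ M * M * (2 * (n * n) * (n * n) ^ (M - 2)) := by
  classical
  -- linearity over ordered index pairs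
  have hlin : ∑ ω : Fin M → Fin n × Fin n, repCount ω =
      ∑ ij ∈ (univ : Finset (Fin M)).offDiag,
        ((univ : Finset (Fin M → Fin n × Fin n)).filter fun ω => s((ω ij.1).1, (ω ij.1).2) = s((ω ij.2).1, (ω ij.2).2)).card := by
    unfold repCount
    simp_rw [Finset.card_filter]
    rw [Finset.sum_comm]
  rw [hlin]
  have hpair : ∀ ij ∈ (univ : Finset (Fin M)).offDiag,
      ((univ : Finset (Fin M → Fin n × Fin n)).filter fun ω => s((ω ij.1).1, (ω ij.1).2) = s((ω ij.2).1, (ω ij.2).2)).card ≤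
        2 * (n * n) * (n * n) ^ (M - 2) := by
    rintro ⟨i, j⟩ hij
    rw [mem_offDiag] at hij
    obtain ⟨-, -, hne⟩ := hij
    -- partition by the value of `ω i`
    rw [Finset.card_eq_sum_card_fiberwise (f := fun ω : Fin M → Fin n × Fin n => ω i) (t := univ)
      (fun _ _ => mem_univ _)]
    have hfib : ∀ p : Fin n × Fin n,
        (((univ : Finset (Fin M → Fin n × Fin n)).filter fun ω => s((ω i).1, (ω i).2) = s((ω j).1, (ω j).2)).filter
          fun ω => ω i = p).card ≤ 2 * (n * n) ^ (M - 2) := by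
      intro p
      set B : Fin M → Finset (Fin n × Fin n) := fun k =>
        if k = i then {p} else if k = j then univ.filter (fun q : Fin n × Fin n => s(q.1, q.2) = s(p.1, p.2)) else univ with hB
      have hset : (((univ : Finset (Fin M → Fin n × Fin n)).filter fun ω =>
            s((ω i).1, (ω i).2) = s((ω j).1, (ω j).2)).filter fun ω => ω i = p) =
          univ.filter fun ω => ∀ k, ω k ∈ B k := by
        ext ω
        simp only [mem_filter, mem_univ, true_and, hB]
        constructor
        · rintro ⟨h1, h2⟩ k
          split_ifs with hk hk'
          · subst hk; simp [h2]
          · subst hk'; exact mem_filter.2 ⟨mem_univ _, by rw [← h1, h2]⟩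
          · exact mem_univ _
        · intro h
          have hi := h i; rw [if_pos rfl] at hi
          have hj := h j; rw [if_neg (Ne.symm hne), if_pos rfl] at hj
          rw [mem_singleton] at hi
          exact ⟨by rw [hi]; exact ((mem_filter.1 hj).2).symm, hi⟩
      rw [hset, card_coordConstraints]
      rw [prod_two_exceptions hne (fun k => (B k).card) (N := n * n) (fun k hki hkj => by
        simp only [hB, if_neg hki, if_neg hkj, card_univ, Fintype.card_prod, Fintype.card_fin])]
      simp only [hB, if_pos rfl, card_singleton, one_mul, if_neg (Ne.symm hne)]
      exact Nat.mul_le_mul_right _ (card_mk_eq_le _)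
    calc _ ≤ ∑ _p : Fin n × Fin n, 2 * (n * n) ^ (M - 2) := sum_le_sum fun p _ => hfib p
      _ = 2 * (n * n) * (n * n) ^ (M - 2) := by
          rw [sum_const, card_univ, Fintype.card_prod, Fintype.card_fin, smul_eq_mul]; ring
  calc _ ≤ ∑ _ij ∈ (univ : Finset (Fin M)).offDiag, 2 * (n * n) * (n * n) ^ (M - 2) := sum_le_sum hpair
    _ = (univ : Finset (Fin M)).offDiag.card * (2 * (n * n) * (n * n) ^ (M - 2)) := by
        rw [sum_const, smul_eq_mul]
    _ ≤ M * M * (2 * (n * n) * (n * n) ^ (M - 2)) := by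
        refine Nat.mul_le_mul_right _ ?_
        rw [offDiag_card, card_univ, Fintype.card_fin]
        exact (Nat.sub_le _ _)

/-! ### Locally dense vertex sets -/

/-- The number of sampled pairs inside `W × W`. [cite: AroraBollobasLovaszTourlakis2006, Lemma 2.8 (p. 26: "every subgraph … with ℓ ≤ βn vertices contains at most (1+η)ℓ edges")] -/
def inCount (W : Finset (Fin n)) (ω : Fin M → Fin n × Fin n) : ℕ :=
  ((univ : Finset (Fin M)).filter fun i => ω i ∈ W ×ˢ W).card

/-- **Union bound for locally dense sets**: the outcomes in which SOME `W ∈ 𝒲` carries `≥ r(W)`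
sampled pairs number at most `Σ_{W∈𝒲} C(M, r W)(|W|²)^{r W}(n²)^{M − r W}`.
[cite: AroraBollobasLovaszTourlakis2006, Lemma 2.8 proof (p. 27)] -/
theorem card_exists_dense_le (𝒲 : Finset (Finset (Fin n))) (r : Finset (Fin n) → ℕ) :
    ((univ : Finset (Fin M → Fin n × Fin n)).filter fun ω => ∃ W ∈ 𝒲, r W ≤ inCount W ω).card ≤
      ∑ W ∈ 𝒲, M.choose (r W) * ((W.card * W.card) ^ (r W) * (n * n) ^ (M - r W)) := by
  classical
  have hsub : ((univ : Finset (Fin M → Fin n × Fin n)).filter fun ω => ∃ W ∈ 𝒲, r W ≤ inCount W ω) ⊆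
      𝒲.biUnion fun W => univ.filter fun ω =>
        r W ≤ ((univ : Finset (Fin M)).filter fun i => ω i ∈ W ×ˢ W).card := by
    intro ω hω
    obtain ⟨W, hW, hr⟩ := (mem_filter.1 hω).2
    exact mem_biUnion.2 ⟨W, hW, mem_filter.2 ⟨mem_univ _, hr⟩⟩
  refine (card_le_card hsub).trans (card_biUnion_le.trans (sum_le_sum fun W _ => ?_))
  have := card_atLeast_le (M := M) (W ×ˢ W) (r W)
  rwa [card_product, Fintype.card_prod, Fintype.card_fin] at this

/-! ### Degrees -/

/-- The ordered pairs containing the vertex `v`. [cite: CharikarMakarychevMakarychev2009, §5 (p. 11: "maximum degree ∆")] -/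
def incPairs (v : Fin n) : Finset (Fin n × Fin n) := (univ : Finset (Fin n × Fin n)).filter fun p => p.1 = v ∨ p.2 = v

/-- The degree of `v` in the sampled multigraph (pairs containing `v`, loops counted once).
[cite: CharikarMakarychevMakarychev2009, §5 (p. 11)] -/
def deg (v : Fin n) (ω : Fin M → Fin n × Fin n) : ℕ :=
  ((univ : Finset (Fin M)).filter fun i => ω i ∈ incPairs v).card

/-- `|incPairs v| ≤ 2n`. [cite: CharikarMakarychevMakarychev2009, §5 (p. 11)] -/
theorem card_incPairs_le (v : Fin n) : (incPairs v).card ≤ 2 * n := by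
  classical
  calc (incPairs v).card ≤ (((univ : Finset (Fin n)).image fun b => (v, b)) ∪
        ((univ : Finset (Fin n)).image fun a => (a, v))).card := by
          refine card_le_card fun p hp => ?_
          rcases (mem_filter.1 hp).2 with h | h
          · exact mem_union_left _ (mem_image.2 ⟨p.2, mem_univ _, by rw [← h]⟩)
          · exact mem_union_right _ (mem_image.2 ⟨p.1, mem_univ _, by rw [← h]⟩)
    _ ≤ ((univ : Finset (Fin n)).image fun b => (v, b)).card + ((univ : Finset (Fin n)).image fun a => (a, v)).card :=
          card_union_le _ _
    _ ≤ n + n := add_le_add (card_image_le.trans (by simp)) (card_image_le.trans (by simp))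
    _ = 2 * n := by ring

/-- **Second moment of a degree**: `Σ_ω deg_v(ω)² ≤ M·2n·(n²)^{M−1} + M²·(2n)²·(n²)^{M−2}`.
[cite: AroraBollobasLovaszTourlakis2006, Lemma 2.8 proof (p. 26–27)] -/
theorem sum_sq_deg_le (v : Fin n) :
    ∑ ω : Fin M → Fin n × Fin n, deg v ω ^ 2 ≤
      M * (2 * n * (n * n) ^ (M - 1)) + M * M * ((2 * n) ^ 2 * (n * n) ^ (M - 2)) := by
  classical
  -- `deg² = Σ_{i,j} X_i X_j`
  have hsq : ∀ ω : Fin M → Fin n × Fin n, deg v ω ^ 2 =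
      ∑ i, ∑ j, (if ω i ∈ incPairs v then 1 else 0) * (if ω j ∈ incPairs v then 1 else 0) := by
    intro ω
    rw [deg, Finset.card_filter, sq, Finset.sum_mul_sum]
  simp_rw [hsq]
  rw [Finset.sum_comm]
  have hij : ∀ i j : Fin M, ∑ ω : Fin M → Fin n × Fin n,
      (if ω i ∈ incPairs v then 1 else 0) * (if ω j ∈ incPairs v then 1 else 0) =
      ((univ : Finset (Fin M → Fin n × Fin n)).filter fun ω => ∀ k ∈ ({i, j} : Finset (Fin M)), ω k ∈ incPairs v).card := by
    intro i j
    rw [Finset.card_filter]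
    refine Finset.sum_congr rfl fun ω _ => ?_
    by_cases h1 : ω i ∈ incPairs v <;> by_cases h2 : ω j ∈ incPairs v <;> simp [h1, h2]
  have hterm : ∀ i j : Fin M, ((univ : Finset (Fin M → Fin n × Fin n)).filter fun ω =>
      ∀ k ∈ ({i, j} : Finset (Fin M)), ω k ∈ incPairs v).card ≤
      (if i = j then 2 * n * (n * n) ^ (M - 1) else (2 * n) ^ 2 * (n * n) ^ (M - 2)) := by
    intro i j
    rw [card_mem_on, Fintype.card_prod, Fintype.card_fin]
    by_cases h : i = j
    · subst h
      rw [if_pos rfl, Finset.pair_eq_singleton, card_singleton, pow_one]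
      exact Nat.mul_le_mul_right _ (card_incPairs_le v)
    · rw [if_neg h, card_pair h]
      exact Nat.mul_le_mul_right _ (Nat.pow_le_pow_left (card_incPairs_le v) 2)
  calc ∑ i, ∑ ω : Fin M → Fin n × Fin n, ∑ j,
        (if ω i ∈ incPairs v then 1 else 0) * (if ω j ∈ incPairs v then 1 else 0)
      = ∑ i, ∑ j, ((univ : Finset (Fin M → Fin n × Fin n)).filter fun ω =>
          ∀ k ∈ ({i, j} : Finset (Fin M)), ω k ∈ incPairs v).card := by
        refine Finset.sum_congr rfl fun i _ => ?_
        rw [Finset.sum_comm]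
        exact Finset.sum_congr rfl fun j _ => hij i j
    _ ≤ ∑ i : Fin M, ∑ j : Fin M, (if i = j then 2 * n * (n * n) ^ (M - 1) else (2 * n) ^ 2 * (n * n) ^ (M - 2)) :=
        sum_le_sum fun i _ => sum_le_sum fun j _ => hterm i j
    _ ≤ M * (2 * n * (n * n) ^ (M - 1)) + M * M * ((2 * n) ^ 2 * (n * n) ^ (M - 2)) := by
        have : ∀ i : Fin M, ∑ j : Fin M, (if i = j then 2 * n * (n * n) ^ (M - 1) else (2 * n) ^ 2 * (n * n) ^ (M - 2))
            ≤ 2 * n * (n * n) ^ (M - 1) + M * ((2 * n) ^ 2 * (n * n) ^ (M - 2)) := by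
          intro i
          rw [← Finset.sum_filter_add_sum_filter_not univ (fun j => i = j)]
          have h1 : ((univ : Finset (Fin M)).filter fun j => i = j) = {i} := by ext j; simp [eq_comm]
          rw [h1, sum_singleton, if_pos rfl]
          refine Nat.add_le_add_left ?_ _
          calc _ = ∑ j ∈ univ.filter (fun j => ¬ i = j), (2 * n) ^ 2 * (n * n) ^ (M - 2) :=
                sum_congr rfl fun j hj => by rw [if_neg (mem_filter.1 hj).2]
            _ ≤ ∑ _j : Fin M, (2 * n) ^ 2 * (n * n) ^ (M - 2) :=
                sum_le_sum_of_subset_of_nonneg (filter_subset _ _) fun _ _ _ => Nat.zero_le _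
            _ = M * ((2 * n) ^ 2 * (n * n) ^ (M - 2)) := by
                rw [sum_const, card_univ, Fintype.card_fin, smul_eq_mul]
        calc _ ≤ ∑ _i : Fin M, (2 * n * (n * n) ^ (M - 1) + M * ((2 * n) ^ 2 * (n * n) ^ (M - 2))) :=
              sum_le_sum fun i _ => this i
          _ = _ := by rw [sum_const, card_univ, Fintype.card_fin, smul_eq_mul]; ring

/-- The number of incidences at vertices of degree `≥ D` (an upper bound for the number of sampled
pairs touching such a vertex). [cite: CharikarMakarychevMakarychev2009, §5 (p. 11: "maximum degree ∆")] -/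
def highInc (D : ℕ) (ω : Fin M → Fin n × Fin n) : ℕ := ∑ v : Fin n, if D ≤ deg v ω then deg v ω else 0

/-- **First moment of the high-degree incidences**: `D · Σ_ω highInc_D(ω) ≤ Σ_v Σ_ω deg_v²`.
[cite: AroraBollobasLovaszTourlakis2006, Lemma 2.8 proof (p. 26–27: Markov)] -/
theorem mul_sum_highInc_le (D : ℕ) :
    D * ∑ ω : Fin M → Fin n × Fin n, highInc D ω ≤
      n * (M * (2 * n * (n * n) ^ (M - 1)) + M * M * ((2 * n) ^ 2 * (n * n) ^ (M - 2))) := by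
  classical
  unfold highInc
  simp_rw [Finset.mul_sum]
  rw [Finset.sum_comm]
  calc ∑ v : Fin n, ∑ ω : Fin M → Fin n × Fin n, D * (if D ≤ deg v ω then deg v ω else 0)
      ≤ ∑ v : Fin n, ∑ ω : Fin M → Fin n × Fin n, deg v ω ^ 2 := by
        refine sum_le_sum fun v _ => sum_le_sum fun ω _ => ?_
        split_ifs with h
        · rw [sq]; exact Nat.mul_le_mul_right _ h
        · simp
    _ ≤ ∑ _v : Fin n, (M * (2 * n * (n * n) ^ (M - 1)) + M * M * ((2 * n) ^ 2 * (n * n) ^ (M - 2))) :=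
        sum_le_sum fun v _ => sum_sq_deg_le v
    _ = _ := by rw [sum_const, card_univ, Fintype.card_fin, smul_eq_mul]

/-! ### Short cycles: closed tuples of sampled pairs -/

/-- **Closed tuples of length `j`** ("potential cycles of length `j`"): distinct indices
`ι : Fin j ↪ Fin M` and vertices `ν : Fin j → Fin n` with `ω(ι t) = {ν t, ν (t+1 mod j)}` for all
`t`. [cite: AroraBollobasLovaszTourlakis2006, Lemma 2.8 proof (p. 27: "the expected number of cycles of length at most g")] -/
def circuits (j : ℕ) (ω : Fin M → Fin n × Fin n) : Finset ((Fin j ↪ Fin M) × (Fin j → Fin n)) :=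
  (univ : Finset ((Fin j ↪ Fin M) × (Fin j → Fin n))).filter fun ιν =>
    ∀ t : Fin j, s((ω (ιν.1 t)).1, (ω (ιν.1 t)).2) = s(ιν.2 t, ιν.2 (finRotate j t))

/-- The outcomes realising a fixed closed tuple number `≤ 2^j (n²)^{M−j}`.
[cite: AroraBollobasLovaszTourlakis2006, Lemma 2.8 proof (p. 27)] -/
theorem card_realise_le {j : ℕ} (ι : Fin j ↪ Fin M) (e : Fin j → Sym2 (Fin n)) :
    ((univ : Finset (Fin M → Fin n × Fin n)).filter fun ω =>
        ∀ t : Fin j, s((ω (ι t)).1, (ω (ι t)).2) = e t).card ≤ 2 ^ j * (n * n) ^ (M - j) := by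
  classical
  set B : Fin M → Finset (Fin n × Fin n) := fun k =>
    univ.filter fun p => ∀ t : Fin j, ι t = k → s(p.1, p.2) = e t with hB
  have hset : ((univ : Finset (Fin M → Fin n × Fin n)).filter fun ω =>
        ∀ t : Fin j, s((ω (ι t)).1, (ω (ι t)).2) = e t) = univ.filter fun ω => ∀ k, ω k ∈ B k := by
    ext ω
    simp only [mem_filter, mem_univ, true_and, hB]
    constructor
    · rintro h k t rfl; exact h t
    · intro h t; exact h (ι t) t rfl
  rw [hset, card_coordConstraints]
  set R : Finset (Fin M) := univ.map ι with hR
  have hRc : R.card = j := by rw [hR, card_map, card_univ, Fintype.card_fin]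
  rw [← Finset.prod_mul_prod_compl R]
  have h1 : ∏ k ∈ R, (B k).card ≤ 2 ^ j := by
    rw [← hRc, ← prod_const]
    refine Finset.prod_le_prod' fun k hk => ?_
    obtain ⟨t, -, rfl⟩ := mem_map.1 hk
    calc (B (ι t)).card ≤ ((univ : Finset (Fin n × Fin n)).filter fun q : Fin n × Fin n => s(q.1, q.2) = e t).card :=
          card_le_card fun p hp => mem_filter.2 ⟨mem_univ _, (mem_filter.1 hp).2 t rfl⟩
      _ ≤ 2 := card_mk_eq_le (e t)
  have h2 : ∏ k ∈ Rᶜ, (B k).card = (n * n) ^ (M - j) := by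
    rw [Finset.prod_congr rfl fun k hk => ?_, prod_const, Finset.card_compl, hRc, Fintype.card_fin]
    -- off the range the constraint is vacuous
    have hk' : ∀ t, ι t ≠ k := fun t h => (mem_compl.1 hk) (mem_map.2 ⟨t, mem_univ _, h⟩)
    have : B k = univ := by
      ext p; simp only [hB, mem_filter, mem_univ, true_and, iff_true]
      intro t ht; exact absurd ht (hk' t)
    rw [this, card_univ, Fintype.card_prod, Fintype.card_fin]
  calc (∏ k ∈ R, (B k).card) * ∏ k ∈ Rᶜ, (B k).card ≤ 2 ^ j * ∏ k ∈ Rᶜ, (B k).card :=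
        Nat.mul_le_mul_right _ h1
    _ = 2 ^ j * (n * n) ^ (M - j) := by rw [h2]

/-- **First moment of the closed tuples of length `j`**: `Σ_ω #circuits_j(ω) ≤ M^j n^j 2^j (n²)^{M−j}`
(mean `≤ (2M/n)^j`). [cite: AroraBollobasLovaszTourlakis2006, Lemma 2.8 proof (p. 27: "Σ_{ℓ ≤ g} λ^ℓ")] -/
theorem sum_card_circuits_le (j : ℕ) :
    ∑ ω : Fin M → Fin n × Fin n, (circuits j ω).card ≤ M ^ j * n ^ j * (2 ^ j * (n * n) ^ (M - j)) := by
  classical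
  have hlin : ∑ ω : Fin M → Fin n × Fin n, (circuits j ω).card =
      ∑ ιν : (Fin j ↪ Fin M) × (Fin j → Fin n),
        ((univ : Finset (Fin M → Fin n × Fin n)).filter fun ω =>
          ∀ t : Fin j, s((ω (ιν.1 t)).1, (ω (ιν.1 t)).2) = s(ιν.2 t, ιν.2 (finRotate j t))).card := by
    unfold circuits
    simp_rw [Finset.card_filter]
    rw [Finset.sum_comm]
  rw [hlin]
  calc _ ≤ ∑ _ιν : (Fin j ↪ Fin M) × (Fin j → Fin n), 2 ^ j * (n * n) ^ (M - j) :=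
        sum_le_sum fun ιν _ => card_realise_le ιν.1 _
    _ = (Fintype.card (Fin j ↪ Fin M) * n ^ j) * (2 ^ j * (n * n) ^ (M - j)) := by
        rw [sum_const, card_univ, Fintype.card_prod, Fintype.card_fun, Fintype.card_fin,
          Fintype.card_fin, smul_eq_mul]
    _ ≤ M ^ j * n ^ j * (2 ^ j * (n * n) ^ (M - j)) := by
        refine Nat.mul_le_mul_right _ (Nat.mul_le_mul_right _ ?_)
        rw [Fintype.card_embedding_eq, Fintype.card_fin, Fintype.card_fin]
        exact Nat.descFactorial_le_pow _ _

/-- The indices lying on some closed tuple of length `j`. [cite: AroraBollobasLovaszTourlakis2006, Lemma 2.8 proof (p. 27: "Deleting an edge from each of these cycles")] -/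
def cycIdxLen (j : ℕ) (ω : Fin M → Fin n × Fin n) : Finset (Fin M) :=
  (circuits j ω).biUnion fun ιν => (univ : Finset (Fin j)).map ιν.1

/-- The indices lying on some closed tuple of length `≤ g`. [cite: AroraBollobasLovaszTourlakis2006, Lemma 2.8 proof (p. 27)] -/
def cycIdx (g : ℕ) (ω : Fin M → Fin n × Fin n) : Finset (Fin M) :=
  (range (g + 1)).biUnion fun j => cycIdxLen j ω

/-- `|cycIdxLen j ω| ≤ j · #circuits_j(ω)`. [cite: AroraBollobasLovaszTourlakis2006, Lemma 2.8 proof (p. 27)] -/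
theorem card_cycIdxLen_le (j : ℕ) (ω : Fin M → Fin n × Fin n) :
    (cycIdxLen j ω).card ≤ j * (circuits j ω).card := by
  classical
  unfold cycIdxLen
  refine card_biUnion_le.trans ?_
  rw [mul_comm, ← smul_eq_mul, ← sum_const]
  refine sum_le_sum fun ιν _ => ?_
  rw [card_map, card_univ, Fintype.card_fin]

/-- `|cycIdx g ω| ≤ Σ_{j ≤ g} j · #circuits_j(ω)`. [cite: AroraBollobasLovaszTourlakis2006, Lemma 2.8 proof (p. 27)] -/
theorem card_cycIdx_le (g : ℕ) (ω : Fin M → Fin n × Fin n) :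
    (cycIdx g ω).card ≤ ∑ j ∈ range (g + 1), j * (circuits j ω).card := by
  classical
  unfold cycIdx
  exact card_biUnion_le.trans (sum_le_sum fun j _ => card_cycIdxLen_le j ω)

/-- An index on a closed tuple of length `j ≤ g` lies in `cycIdx g`. [cite: AroraBollobasLovaszTourlakis2006, Lemma 2.8 proof (p. 27)] -/
theorem mem_cycIdx {g j : ℕ} (hj : j ≤ g) {ω : Fin M → Fin n × Fin n}
    {ιν : (Fin j ↪ Fin M) × (Fin j → Fin n)} (h : ιν ∈ circuits j ω) (t : Fin j) :
    ιν.1 t ∈ cycIdx g ω := by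
  classical
  unfold cycIdx cycIdxLen
  exact mem_biUnion.2 ⟨j, mem_range.2 (by omega), mem_biUnion.2 ⟨ιν, h, mem_map.2 ⟨t, mem_univ _, rfl⟩⟩⟩

end RandomPairs

end Literature.Combinatorics.Optimization
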